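import Summits.CriticalPhenomena.PercolationContinuityZ3.Theorems.PercNearOneGluingNoHeavyQuantAnimalSlots
import Mathlib.Algebra.Order.Antidiag.Pi
import HarnessLib

/-!
# QUANT lane / PAPER-2 rate track (ARM-2 = constants bookkeeper, gen 5): the Galton–Watson majorant of lattice animals —
# `#animals ≤ gw Δ (n+1)` and, on `ℤ²` with `★`-steps, `#starAnimals v m ≤ gw 8 m` (`gw 8 = 1, 1, 8, 92, 1240, 18278, …`)

builds on p205010 (kernel theorem, internal audit signed; external expert review pending)

Cell `prim-quant`, seat `prim-quant-arm-2` (RATE-CONSTANTS.md §8 (L1a⁗); `quant/prim-quant-arm-2-g5/STATUS.md`).  Second of three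
combinatorics files (first: `…QuantAnimalSlots`, the slot decomposition; third: `…QuantGWPeierlsCertificate`, the generating-function
majorant and the certificate at `2⁻⁵`).  The exploration-process driver of the effective Kozma–Nitzan Theorem 6 percolates as soon as
the Peierls series `Σ_{t ≥ 0} (9(t+1)+1)·#starAnimals v (t+1)·ε^{t+1}` is `≤ 2/3` (`…QuantPeierlsStarDriver` p244215 at `2⁻⁸` with the walk
count `100^t`; `…QuantPeierlsStarDriverSix` p248971 at `2⁻⁶` with ARM-1's depth-first count `32^t`).  The lane's memos (RATE-PLAN §12.2,
postcont §57) priced the next dyadic rung `2⁻⁵` at "a king's-lattice growth-constant theorem `≤ 10.45` or `★`-circuit topology"; neither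
is needed — the classical tree majorant suffices:

* `gw Δ` — the `Δ`-ary tree numbers: `gw Δ 0 = 1` (empty slot), `gw Δ (n+1) = Σ_{g : Fin Δ → ℕ, Σ g = n} Π_i gw Δ (g i)` (a root and, in
  each of its `Δ` slots, nothing or a smaller tree); `= binom(Δ m, m)/((Δ−1)m+1)`, generating function `C = 1 + x C^Δ`;
* **`card_animals_le_gw`** — in a graph with at most `Δ` listed neighbours per point (`R a b → b ∈ nbr a`, `R` symmetric) the animals
  through `x` with `n + 1` points number at most `gw Δ (n+1)`: strong induction on the slot decomposition (the pair (size vector on the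
  neighbour slots of `x`, one filling per slot) determines the animal; `sum_piAntidiag_prod_le` re-indexes the `≤ Δ` slots into `Fin Δ`,
  empty slots costing `gw Δ 0 = 1`);
* the lattice: `card_starAnimals_le_gw : #starAnimals v m ≤ gw (3^d − 1) m` (`m ≥ 1`, punctured `★`-balls) and `card_starAnimals_two_le_gw`
  (`d = 2`: `Δ = 8`; versus `32^{m−1}` depth-first and `100^{m−1}` by closed walks).

Pure combinatorics; no percolation input.  Class of the rate UNCHANGED by what this feeds (base lever only; honest sentence unchanged).
(Classical: Grimmett, *Percolation* (1999), proof of (4.24); Lyons–Peres, *Probability on Trees and Networks*, Ex. 7.39.) [folklore]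
-/

noncomputable section

namespace Summit.CriticalPhenomena.PercolationContinuityZ3.Theorems.Quant.GWCount

open Finset Relation
open scoped Classical

/-! ## The `Δ`-ary tree numbers `gw Δ m` (Galton–Watson / Fuss–Catalan majorant) -/

/-- **The majorant sequence** `gw Δ`: `gw Δ 0 = 1` (the empty slot) and `gw Δ (n+1) = Σ_{g : Fin Δ → ℕ, Σ g = n} Π_i gw Δ (g i)`
(a root and, in each of its `Δ` slots, nothing or a smaller tree) — the number of `Δ`-ary plane trees with `n + 1` nodes,
`binom(Δ(n+1), n+1)/((Δ−1)(n+1)+1)`; generating function `C = 1 + x·C^Δ`.  For `Δ = 8`: `1, 1, 8, 92, 1240, 18278, …`.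
builds on p205010 (kernel theorem, internal audit signed; external expert review pending). [folklore] -/
def gw (Δ : ℕ) : ℕ → ℕ
  | 0 => 1
  | n + 1 => ∑ g ∈ (piAntidiag (univ : Finset (Fin Δ)) n).attach, ∏ i, gw Δ (g.1 i)
decreasing_by
  have hg : ∑ j, g.1 j = n := (Finset.mem_piAntidiag.1 g.2).1
  have hle : g.1 i ≤ ∑ j, g.1 j := Finset.single_le_sum (fun j _ => Nat.zero_le (g.1 j)) (Finset.mem_univ i)
  omega

/-- `gw Δ 0 = 1` (the empty slot). [folklore] -/
@[simp] theorem gw_zero (Δ : ℕ) : gw Δ 0 = 1 := by rw [gw]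

/-- The tree recursion: `gw Δ (n+1) = Σ_{Σ g = n} Π_i gw Δ (g i)`. [folklore] -/
theorem gw_succ (Δ n : ℕ) : gw Δ (n + 1) = ∑ g ∈ piAntidiag (univ : Finset (Fin Δ)) n, ∏ i, gw Δ (g i) := by
  rw [gw, Finset.sum_attach (piAntidiag (univ : Finset (Fin Δ)) n) (fun g => ∏ i, gw Δ (g i))]

/-- `gw Δ 1 = 1` (a single root). [folklore] -/
@[simp] theorem gw_one (Δ : ℕ) : gw Δ 1 = 1 := by
  rw [gw_succ, piAntidiag_zero, sum_singleton]
  simp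

/-! ## Transfer of slot sums to `Fin Δ` -/

/-- Re-indexing a sum over size vectors on a slot type `ι` with `card ι ≤ Δ` into the `Fin Δ`-indexed sum defining `gw`
(extend by empty slots; `c 0 = 1`). [folklore] -/
theorem sum_piAntidiag_prod_le {ι : Type*} [Fintype ι] [DecidableEq ι] (c : ℕ → ℕ) (hc0 : c 0 = 1) {Δ : ℕ}
    (hι : Fintype.card ι ≤ Δ) (n : ℕ) :
    ∑ g ∈ piAntidiag (univ : Finset ι) n, ∏ a, c (g a) ≤ ∑ g ∈ piAntidiag (univ : Finset (Fin Δ)) n, ∏ i, c (g i) := by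
  -- an embedding `ι ↪ Fin Δ`
  let e : ι ↪ Fin Δ := (Fintype.equivFin ι).toEmbedding.trans (Fin.castLEEmb hι)
  have he : Function.Injective e := e.injective
  -- extension by zero
  let ext : (ι → ℕ) → (Fin Δ → ℕ) := fun g => Function.extend e g (fun _ => 0)
  have hext_app : ∀ g a, ext g (e a) = g a := fun g a => he.extend_apply g (fun _ => 0) a
  have hext_off : ∀ g i, i ∉ univ.map e → ext g i = 0 := by
    intro g i hi
    have : ¬∃ a, e a = i := fun ⟨a, ha⟩ => hi (mem_map.2 ⟨a, mem_univ a, ha⟩)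
    exact Function.extend_apply' g (fun _ => 0) i this
  have hext_inj : Function.Injective ext := by
    intro g g' h
    funext a
    rw [← hext_app g a, ← hext_app g' a, h]
  have hsum : ∀ g, ∑ i, ext g i = ∑ a, g a := by
    intro g
    rw [← Finset.sum_subset (subset_univ (univ.map e)) (fun i _ hi => hext_off g i hi), sum_map]
    exact sum_congr rfl fun a _ => hext_app g a
  have hprod : ∀ g, ∏ i, c (ext g i) = ∏ a, c (g a) := by
    intro g
    rw [← Finset.prod_subset (subset_univ (univ.map e)) (fun i _ hi => by rw [hext_off g i hi, hc0]), prod_map]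
    exact prod_congr rfl fun a _ => by rw [hext_app g a]
  have hmaps : ∀ g ∈ piAntidiag (univ : Finset ι) n, ext g ∈ piAntidiag (univ : Finset (Fin Δ)) n := by
    intro g hg
    have hs : ∑ a, g a = n := (mem_piAntidiag.1 hg).1
    rw [mem_piAntidiag]
    exact ⟨by rw [← hs]; exact hsum g, fun i _ => mem_univ i⟩
  calc ∑ g ∈ piAntidiag (univ : Finset ι) n, ∏ a, c (g a)
      = ∑ g ∈ piAntidiag (univ : Finset ι) n, ∏ i, c (ext g i) := sum_congr rfl fun g _ => (hprod g).symm
    _ = ∑ h ∈ (piAntidiag (univ : Finset ι) n).image ext, ∏ i, c (h i) := by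
        rw [sum_image fun g _ g' _ hgg' => hext_inj hgg']
    _ ≤ ∑ g ∈ piAntidiag (univ : Finset (Fin Δ)) n, ∏ i, c (g i) :=
        sum_le_sum_of_subset fun h hh => by
          obtain ⟨g, hg, rfl⟩ := mem_image.1 hh
          exact hmaps g hg

/-! ## The count: `#animals ≤ gw Δ (n+1)` -/

section Count

variable {V : Type*} [DecidableEq V] {R : V → V → Prop} {nbr : V → Finset V} {Δ : ℕ}

/-- **THE GALTON–WATSON MAJORANT.**  In a graph whose points have at most `Δ` listed neighbours (`R a b → b ∈ nbr a`, `R`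
symmetric), the number of animals through `x` with `n + 1` points is at most the `Δ`-ary tree number `gw Δ (n+1)`.
(Strong induction: the slot decomposition of `…QuantAnimalSlots` injects the animals with `n + 2` points into pairs
(size vector `k` on the neighbour slots of `x` with `Σ k = n + 1`, a filling of each slot `a` by `∅` or an animal through `a` with
`k a` points); counting the pairs gives `Σ_k Π_a gw Δ (k a) ≤ gw Δ (n+2)`.)
builds on p205010 (kernel theorem, internal audit signed; external expert review pending). [folklore] -/
theorem card_animals_le_gw (hR : ∀ a b, R a b → R b a) (hnbr : ∀ a b, R a b → b ∈ nbr a) (hΔ : ∀ a, (nbr a).card ≤ Δ) :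
    ∀ (n : ℕ) (x : V), (animals R nbr Δ x n).card ≤ gw Δ (n + 1) := by
  intro n
  induction n using Nat.strong_induction_on with
  | _ n ih =>
  intro x
  rcases n with _ | k
  · -- one point: `{x}` only
    rw [gw_one]
    refine card_le_one.2 fun S hS S' hS' => ?_
    rw [mem_animals hnbr hΔ] at hS hS'
    rw [eq_singleton_of_isAnimal hS.2 hS.1, eq_singleton_of_isAnimal hS'.2 hS'.1]
  · -- `k + 2` points: file `S ∖ {x}` into the neighbour slots
    set ι := {a // a ∈ nbr x} with hιdef
    -- admissible fillings of one slot with a prescribed size: `{∅}` for size `0`, the animals through the slot vertex otherwise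
    let T : V → ℕ → Finset (Finset V) := fun a j => if j = 0 then {∅} else animals R nbr Δ a (j - 1)
    let sz : Finset V → (ι → ℕ) := fun S a => (slot R nbr x S a).card
    let Ψ : Finset V → (ι → Finset V) := fun S a => slot R nbr x S a
    let F : Finset V → (Σ _ : ι → ℕ, ι → Finset V) := fun S => ⟨sz S, Ψ S⟩
    let D : Finset (Σ _ : ι → ℕ, ι → Finset V) :=
      (piAntidiag (univ : Finset ι) (k + 1)).sigma fun g => Fintype.piFinset fun a => T (a : V) (g a)
    have hmaps : Set.MapsTo F ↑(animals R nbr Δ x (k + 1)) ↑D := by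
      intro S hS
      rw [mem_coe, mem_animals hnbr hΔ] at hS
      obtain ⟨hcard, hSan⟩ := hS
      rw [mem_coe, mem_sigma]
      refine ⟨?_, ?_⟩
      · rw [mem_piAntidiag]
        refine ⟨?_, fun a _ => mem_univ a⟩
        have h1 := card_eq_sum_card_slot hR hnbr hSan
        rw [show univ.sum (sz S) = ∑ a ∈ nbr x, (slot R nbr x S a).card from
          Finset.sum_coe_sort (nbr x) (fun a => (slot R nbr x S a).card)]
        omega
      · rw [Fintype.mem_piFinset]
        intro a
        change slot R nbr x S a ∈ T (a : V) (slot R nbr x S a).card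
        rcases h0 : (slot R nbr x S a).card with _ | j
        · simp only [T, if_pos rfl, mem_singleton]
          exact card_eq_zero.1 h0
        · simp only [T, Nat.succ_ne_zero, if_false, Nat.add_sub_cancel]
          rw [mem_animals hnbr hΔ]
          exact ⟨h0, isAnimal_slot (card_pos.1 (by omega))⟩
    have hinj : Set.InjOn F ↑(animals R nbr Δ x (k + 1)) := by
      intro S hS S' hS' hFF
      rw [mem_coe, mem_animals hnbr hΔ] at hS hS'
      have hΨ : Ψ S = Ψ S' := (Sigma.mk.inj_iff.1 hFF).2 |> eq_of_heq
      exact eq_of_slot_eq hR hnbr hS.2 hS'.2 fun a ha => congr_fun hΨ ⟨a, ha⟩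
    have hslot : ∀ (a : V) (j : ℕ), j ≤ k + 1 → (T a j).card ≤ gw Δ j := by
      intro a j hj
      rcases j with _ | j
      · simp [T]
      · simp only [T, Nat.succ_ne_zero, if_false, Nat.add_sub_cancel]
        exact ih j (by omega) a
    calc (animals R nbr Δ x (k + 1)).card ≤ D.card := card_le_card_of_injOn F hmaps hinj
      _ = ∑ g ∈ piAntidiag (univ : Finset ι) (k + 1), ∏ a : ι, (T (a : V) (g a)).card := by
          rw [card_sigma]; exact sum_congr rfl fun g _ => Fintype.card_piFinset _
      _ ≤ ∑ g ∈ piAntidiag (univ : Finset ι) (k + 1), ∏ a : ι, gw Δ (g a) := by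
          refine sum_le_sum fun g hg => prod_le_prod (fun a _ => Nat.zero_le _) fun a _ => hslot a (g a) ?_
          have hs : ∑ b, g b = k + 1 := (mem_piAntidiag.1 hg).1
          have := Finset.single_le_sum (fun b _ => Nat.zero_le (g b)) (mem_univ a)
          omega
      _ ≤ ∑ g ∈ piAntidiag (univ : Finset (Fin Δ)) (k + 1), ∏ i, gw Δ (g i) :=
          sum_piAntidiag_prod_le (gw Δ) (gw_zero Δ) (by rw [Fintype.card_coe]; exact hΔ x) (k + 1)
      _ = gw Δ (k + 2) := (gw_succ Δ (k + 1)).symm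

end Count

/-! ## The lattice: `★`-animals of `ℤ^d`, and the `d = 2` certificate at the Peierls constant `2⁻⁵` -/

section Lattice

open Literature.Probability.LatticeModels Literature.Probability.Percolation

variable {d : ℕ}

/-- Every `★`-animal of size `m ≥ 1` through `v` (`Literature.Probability.Percolation.starAnimals`) is an animal through `v` with
`(m − 1) + 1` points for the `★`-step relation and the punctured `★`-balls as neighbour lists. [folklore] -/
theorem starAnimals_subset_animals (v : Site d) {m : ℕ} (hm : 1 ≤ m) :
    starAnimals v m ⊆ animals (fun a b : Site d => b ∈ starBall a ∧ b ≠ a) (fun x : Site d => (starBall x).erase x)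
      (3 ^ d - 1) v (m - 1) := by
  intro Y hY
  simp only [starAnimals, mem_filter, mem_image] at hY
  obtain ⟨⟨l, hl, rfl⟩, hcard⟩ := hY
  obtain ⟨hv, hconn⟩ := DFSCount.lazyWalk_support hl
  rw [mem_animals (fun a b h => mem_erase.2 ⟨h.2, h.1⟩) (fun a => (StarPeierls.card_starBall_erase a).le)]
  exact ⟨by omega, hv, hconn⟩

/-- **`★`-animal count by the Galton–Watson majorant**: `#starAnimals v m ≤ gw (3^d − 1) m` for `m ≥ 1`.
builds on p205010 (kernel theorem, internal audit signed; external expert review pending). [folklore] -/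
theorem card_starAnimals_le_gw (v : Site d) {m : ℕ} (hm : 1 ≤ m) : (starAnimals v m).card ≤ gw (3 ^ d - 1) m := by
  have h := card_animals_le_gw (R := fun a b : Site d => b ∈ starBall a ∧ b ≠ a)
    (nbr := fun x : Site d => (starBall x).erase x) (Δ := 3 ^ d - 1)
    (fun a b h => ⟨mem_starBall_comm.1 h.1, fun e => h.2 e.symm⟩) (fun a b h => mem_erase.2 ⟨h.2, h.1⟩)
    (fun a => (StarPeierls.card_starBall_erase a).le) (m - 1) v
  have e : m - 1 + 1 = m := by omega
  rw [e] at h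
  exact (card_le_card (starAnimals_subset_animals v hm)).trans h

/-- `d = 2`: `#starAnimals v (t+1) ≤ gw 8 (t+1)` (`gw 8 = 1, 1, 8, 92, 1240, 18278, …`; the depth-first count gives `32^t`). [folklore] -/
theorem card_starAnimals_two_le_gw (v : Site 2) (t : ℕ) : (starAnimals v (t + 1)).card ≤ gw 8 (t + 1) := by
  simpa using card_starAnimals_le_gw v (m := t + 1) (by omega)

end Lattice

end Summit.CriticalPhenomena.PercolationContinuityZ3.Theorems.Quant.GWCount

end
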